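import Mathlib
import Literature.Analysis.Convex.RobustLinearConstraints
import HarnessLib

/-!
# Worst-case robust approximation: explicit worst-case errors
(Boyd–Vandenberghe, *Convex Optimization*, §6.4.2)

Source: S. Boyd, L. Vandenberghe, *Convex Optimization*, Cambridge University Press (2004)
[cite: BoydVandenberghe2004] — open copy read, §6.4.2 "Worst-case robust approximation"
(pp. 319–323).  The worst-case error of `x` over an uncertainty set `𝒜` of coefficient matrices is
`e_wc(x) = sup {‖Ax − b‖ | A ∈ 𝒜}`; the section computes it in closed form in four situations,
all formalised here as `IsGreatest` statements (the supremum is attained):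
* *finite set* `𝒜 = conv{A₁, …, A_k}`: `e_wc(x) = maxᵢ ‖Aᵢx − b‖`;
* *norm bound error* `𝒜 = {Ā + U | ‖U‖ ≤ a}` (Euclidean norms, induced operator norm):
  `e_wc(x) = ‖Āx − b‖₂ + a‖x‖₂`, attained at the rank-one `U = a u vᵀ`, `u = (Āx − b)/‖Āx − b‖₂`,
  `v = x/‖x‖₂` ("also valid if `x` or `Āx − b` is zero") — so the robust approximation problem is
  the regularised norm problem `minimize ‖Āx − b‖₂ + a‖x‖₂`;
* *uncertainty ellipsoids* for the rows, `ℰᵢ = {āᵢ + Pᵢu | ‖u‖₂ ≤ 1}`: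
  `sup_{aᵢ ∈ ℰᵢ} |aᵢᵀx − bᵢ| = |āᵢᵀx − bᵢ| + ‖Pᵢᵀx‖₂`, and for the robust `ℓ₂` problem
  `e_wc(x) = (∑ᵢ (|āᵢᵀx − bᵢ| + ‖Pᵢᵀx‖₂)²)^{1/2}`;
* *robust Chebyshev approximation with linear structure*:
  `sup_{‖u‖∞ ≤ 1} |pᵀu + q| = ‖p‖₁ + |q|`.

## Setting and relation to the tree

Normed / inner product spaces over `ℝ` replace `ℝⁿ`, continuous linear maps replace matrices
(`‖U‖` is then the induced norm, i.e. the maximum singular value in the Euclidean case), `Pᵀ` is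
the adjoint.  The row ellipsoids are the tree's `RobustLinearConstraints.ellipsoid ā P` (§4.4.2,
imported; its `isGreatest_inner_ellipsoid` is the one-sided version `sup aᵀx` of the two-sided
`sup |aᵀx − b|` proved here).  The SOCP/LP recastings of the resulting problems are not repeated
(`SecondOrderConePrograms`, `RobustLinearConstraints`).
-/

namespace Literature.Analysis.Convex.WorstCaseRobustApproximation

open Set Metric ContinuousLinearMap
open scoped RealInnerProductSpace
open Literature.Analysis.Convex.RobustLinearConstraints (ellipsoid inner_apply_eq_inner_adjoint)

noncomputable section

/-! ## Finite set: `e_wc(x) = maxᵢ ‖Aᵢx − b‖` over `conv{A₁, …, A_k}` -/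

section FiniteSet

variable {E F : Type*} [NormedAddCommGroup E] [NormedSpace ℝ E] [NormedAddCommGroup F]
  [NormedSpace ℝ F]

/-- `A ↦ ‖Ax − b‖` is a convex function of the coefficient map.
[cite: BoydVandenberghe2004, §6.4.2] -/
theorem convexOn_norm_residual (x : E) (b : F) :
    ConvexOn ℝ univ fun A : E →L[ℝ] F => ‖A x - b‖ := by
  refine ⟨convex_univ, fun A _ B _ μ ν hμ hν hμν => ?_⟩
  show ‖(μ • A + ν • B) x - b‖ ≤ μ • ‖A x - b‖ + ν • ‖B x - b‖
  have : (μ • A + ν • B) x - b = μ • (A x - b) + ν • (B x - b) := by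
    simp only [add_apply, smul_apply, smul_sub]
    rw [show μ • A x - μ • b + (ν • B x - ν • b) = μ • A x + ν • B x - (μ + ν) • b by
      rw [add_smul]; abel, hμν, one_smul]
  rw [this, smul_eq_mul, smul_eq_mul]
  exact (norm_add_le _ _).trans (by rw [norm_smul, norm_smul, Real.norm_of_nonneg hμ,
    Real.norm_of_nonneg hν])

variable {ι : Type*} [Fintype ι] [Nonempty ι]

/-- **Finite uncertainty set**: over `conv{A₁, …, A_k}` the worst-case error is
`maxᵢ ‖Aᵢx − b‖`, attained at one of the `Aᵢ`. [cite: BoydVandenberghe2004, §6.4.2] -/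
theorem isGreatest_norm_residual_convexHull (A : ι → E →L[ℝ] F) (b : F) (x : E) :
    IsGreatest ((fun B : E →L[ℝ] F => ‖B x - b‖) '' convexHull ℝ (range A))
      (Finset.univ.sup' Finset.univ_nonempty fun i => ‖A i x - b‖) := by
  constructor
  · obtain ⟨i, -, hi⟩ := Finset.exists_mem_eq_sup' Finset.univ_nonempty fun i => ‖A i x - b‖
    exact ⟨A i, subset_convexHull ℝ _ (mem_range_self i), hi.symm⟩
  · rintro _ ⟨B, hB, rfl⟩
    obtain ⟨_, ⟨i, rfl⟩, hi⟩ :=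
      (convexOn_norm_residual x b).exists_ge_of_mem_convexHull (subset_univ _) hB
    exact hi.trans (Finset.le_sup' (fun i => ‖A i x - b‖) (Finset.mem_univ i))

end FiniteSet

/-! ## Norm bound error: `e_wc(x) = ‖Āx − b‖₂ + a‖x‖₂` -/

section NormBound

variable {E F : Type*} [NormedAddCommGroup E] [NormedSpace ℝ E] [NormedAddCommGroup F]
  [NormedSpace ℝ F]

/-- The set of errors `‖(Ā + U)x − b‖` over the norm ball `‖U‖ ≤ a`.
[cite: BoydVandenberghe2004, §6.4.2] -/
def wcValues (A : E →L[ℝ] F) (b : F) (a : ℝ) (x : E) : Set ℝ :=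
  (fun U : E →L[ℝ] F => ‖(A + U) x - b‖) '' {U | ‖U‖ ≤ a}

/-- The worst-case error `e_wc(x) = sup {‖(Ā + U)x − b‖ | ‖U‖ ≤ a}`.
[cite: BoydVandenberghe2004, §6.4.2] -/
def ewc (A : E →L[ℝ] F) (b : F) (a : ℝ) (x : E) : ℝ := sSup (wcValues A b a x)

/-- The easy bound `‖(Ā + U)x − b‖ ≤ ‖Āx − b‖ + a‖x‖` for `‖U‖ ≤ a` (any normed spaces, induced
norm). [cite: BoydVandenberghe2004, §6.4.2] -/
theorem norm_residual_add_le (A : E →L[ℝ] F) (b : F) {a : ℝ} (x : E) {U : E →L[ℝ] F}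
    (hU : ‖U‖ ≤ a) : ‖(A + U) x - b‖ ≤ ‖A x - b‖ + a * ‖x‖ := by
  rw [add_apply, show A x + U x - b = (A x - b) + U x by abel]
  exact (norm_add_le _ _).trans (by gcongr; exact U.le_of_opNorm_le hU x)

/-- [cite: BoydVandenberghe2004, §6.4.2] -/
theorem mem_upperBounds_wcValues (A : E →L[ℝ] F) (b : F) (a : ℝ) (x : E) :
    ‖A x - b‖ + a * ‖x‖ ∈ upperBounds (wcValues A b a x) := by
  rintro _ ⟨U, hU, rfl⟩; exact norm_residual_add_le A b x hU

/-- [cite: BoydVandenberghe2004, §6.4.2] -/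
theorem norm_residual_mem_wcValues (A : E →L[ℝ] F) (b : F) {a : ℝ} (ha : 0 ≤ a) (x : E) :
    ‖A x - b‖ ∈ wcValues A b a x :=
  ⟨0, by simpa using ha, by simp⟩

end NormBound

section NormBoundEuclidean

variable {E F : Type*} [NormedAddCommGroup E] [InnerProductSpace ℝ E] [NormedAddCommGroup F]
  [InnerProductSpace ℝ F]

/-- The outer product (rank-one map) `u vᵀ : y ↦ (vᵀy) u`.
[cite: BoydVandenberghe2004, §6.4.2] -/
def outerProduct (u : F) (v : E) : E →L[ℝ] F := (innerSL ℝ v).smulRight u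

/-- [cite: BoydVandenberghe2004, §6.4.2] -/
@[simp] theorem outerProduct_apply (u : F) (v y : E) : outerProduct u v y = ⟪v, y⟫ • u := by
  simp [outerProduct]

/-- `‖u vᵀ‖ = ‖u‖₂‖v‖₂` for the induced norm. [cite: BoydVandenberghe2004, §6.4.2] -/
theorem norm_outerProduct (u : F) (v : E) : ‖outerProduct u v‖ = ‖u‖ * ‖v‖ := by
  rw [outerProduct, norm_smulRight_apply, innerSL_apply_norm, mul_comm]

/-- The book's worst perturbation `U = a u vᵀ`, `u = (Āx − b)/‖Āx − b‖₂`, `v = x/‖x‖₂`.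
[cite: BoydVandenberghe2004, §6.4.2] -/
def worstU (A : E →L[ℝ] F) (b : F) (a : ℝ) (x : E) : E →L[ℝ] F :=
  (a / (‖A x - b‖ * ‖x‖)) • outerProduct (A x - b) x

/-- `‖a u vᵀ‖ = a`. [cite: BoydVandenberghe2004, §6.4.2] -/
theorem norm_worstU {A : E →L[ℝ] F} {b : F} {a : ℝ} (ha : 0 ≤ a) {x : E} (hr : A x - b ≠ 0)
    (hx : x ≠ 0) : ‖worstU A b a x‖ = a := by
  rw [worstU, norm_smul, norm_outerProduct, Real.norm_of_nonneg (by positivity)]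
  field_simp [norm_ne_zero_iff.mpr hr, norm_ne_zero_iff.mpr hx]

/-- `U x = (a‖x‖₂/‖Āx − b‖₂)(Āx − b)`. [cite: BoydVandenberghe2004, §6.4.2] -/
theorem worstU_apply_self (A : E →L[ℝ] F) (b : F) (a : ℝ) {x : E} (hx : x ≠ 0) :
    worstU A b a x x = (a * ‖x‖ / ‖A x - b‖) • (A x - b) := by
  rw [worstU, smul_apply, outerProduct_apply, smul_smul, real_inner_self_eq_norm_sq]
  congr 1
  field_simp [norm_ne_zero_iff.mpr hx]

/-- At the worst perturbation the error is `‖Āx − b‖₂ + a‖x‖₂`.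
[cite: BoydVandenberghe2004, §6.4.2] -/
theorem norm_residual_worstU {A : E →L[ℝ] F} {b : F} {a : ℝ} (ha : 0 ≤ a) {x : E}
    (hr : A x - b ≠ 0) (hx : x ≠ 0) :
    ‖(A + worstU A b a x) x - b‖ = ‖A x - b‖ + a * ‖x‖ := by
  have hr' : ‖A x - b‖ ≠ 0 := norm_ne_zero_iff.mpr hr
  rw [add_apply, worstU_apply_self A b a hx,
    show A x + (a * ‖x‖ / ‖A x - b‖) • (A x - b) - b = (1 + a * ‖x‖ / ‖A x - b‖) • (A x - b) by
      rw [add_smul, one_smul]; abel,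
    norm_smul, Real.norm_of_nonneg (by positivity)]
  field_simp

/-- **Norm bound error, main case** (`x ≠ 0`, `Āx ≠ b`): the supremum `‖Āx − b‖₂ + a‖x‖₂` is
attained at `U = a u vᵀ`. [cite: BoydVandenberghe2004, §6.4.2] -/
theorem isGreatest_wcValues_of_ne {A : E →L[ℝ] F} {b : F} {a : ℝ} (ha : 0 ≤ a) {x : E}
    (hr : A x - b ≠ 0) (hx : x ≠ 0) :
    IsGreatest (wcValues A b a x) (‖A x - b‖ + a * ‖x‖) :=
  ⟨⟨worstU A b a x, (norm_worstU ha hr hx).le, norm_residual_worstU ha hr hx⟩,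
    mem_upperBounds_wcValues A b a x⟩

/-- **Norm bound error, all cases** ("this expression is also valid if `x` or `Āx − b` is
zero"; the target space must be nontrivial for the case `Āx = b`, `x ≠ 0`).
[cite: BoydVandenberghe2004, §6.4.2] -/
theorem isGreatest_wcValues [Nontrivial F] (A : E →L[ℝ] F) (b : F) {a : ℝ} (ha : 0 ≤ a)
    (x : E) : IsGreatest (wcValues A b a x) (‖A x - b‖ + a * ‖x‖) := by
  refine ⟨?_, mem_upperBounds_wcValues A b a x⟩
  by_cases hx : x = 0
  · simpa [hx] using norm_residual_mem_wcValues A b ha x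
  by_cases hr : A x - b = 0
  · -- `Āx = b`: perturb along any unit direction `u₀` of `F`
    obtain ⟨u₀, hu₀⟩ := exists_ne (0 : F)
    have hx' : ‖x‖ ≠ 0 := norm_ne_zero_iff.mpr hx
    have hu₀' : ‖u₀‖ ≠ 0 := norm_ne_zero_iff.mpr hu₀
    refine ⟨(a / (‖u₀‖ * ‖x‖)) • outerProduct u₀ x, ?_, ?_⟩
    · rw [mem_setOf_eq, norm_smul, norm_outerProduct, Real.norm_of_nonneg (by positivity),
        div_mul_cancel₀ _ (mul_ne_zero hu₀' hx')]
    · show ‖(A + (a / (‖u₀‖ * ‖x‖)) • outerProduct u₀ x) x - b‖ = ‖A x - b‖ + a * ‖x‖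
      rw [add_apply, show A x + ((a / (‖u₀‖ * ‖x‖)) • outerProduct u₀ x) x - b =
          (A x - b) + ((a / (‖u₀‖ * ‖x‖)) • outerProduct u₀ x) x by abel, hr, zero_add, norm_zero,
          zero_add, smul_apply, outerProduct_apply, smul_smul, norm_smul,
          real_inner_self_eq_norm_sq, Real.norm_of_nonneg (by positivity)]
      field_simp
  · exact (isGreatest_wcValues_of_ne ha hr hx).1

/-- `e_wc(x) = ‖Āx − b‖₂ + a‖x‖₂`. [cite: BoydVandenberghe2004, §6.4.2] -/
theorem ewc_eq [Nontrivial F] (A : E →L[ℝ] F) (b : F) {a : ℝ} (ha : 0 ≤ a) (x : E) :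
    ewc A b a x = ‖A x - b‖ + a * ‖x‖ :=
  (isGreatest_wcValues A b ha x).csSup_eq

/-- Hence the robust approximation problem `minimize e_wc(x)` IS the regularised norm problem
`minimize ‖Āx − b‖₂ + a‖x‖₂` (same objective function, so same minimisers on any set).
[cite: BoydVandenberghe2004, §6.4.2] -/
theorem isMinOn_ewc_iff [Nontrivial F] (A : E →L[ℝ] F) (b : F) {a : ℝ} (ha : 0 ≤ a)
    (s : Set E) (x : E) :
    IsMinOn (ewc A b a) s x ↔ IsMinOn (fun y => ‖A y - b‖ + a * ‖y‖) s x := by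
  have : ewc A b a = fun y => ‖A y - b‖ + a * ‖y‖ := funext fun y => ewc_eq A b ha y
  rw [this]

end NormBoundEuclidean

/-! ## Uncertainty ellipsoids for the rows -/

section Ellipsoids

variable {V : Type*} [NormedAddCommGroup V] [InnerProductSpace ℝ V]

/-- `sup_{‖u‖₂ ≤ 1} |c + wᵀu| = |c| + ‖w‖₂`, attained at `u = ±w/‖w‖₂`.
[cite: BoydVandenberghe2004, §6.4.2] -/
theorem isGreatest_abs_add_inner_closedBall (c : ℝ) (w : V) :
    IsGreatest ((fun u : V => |c + ⟪w, u⟫|) '' closedBall 0 1) (|c| + ‖w‖) := by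
  constructor
  · by_cases hw : w = 0
    · exact ⟨0, by simp, by simp [hw]⟩
    have hw' : ‖w‖ ≠ 0 := norm_ne_zero_iff.mpr hw
    set s : ℝ := if 0 ≤ c then 1 else -1 with hs
    have hs1 : |s| = 1 := by rw [hs]; split_ifs <;> simp
    refine ⟨(s / ‖w‖) • w, ?_, ?_⟩
    · rw [mem_closedBall_zero_iff, norm_smul, norm_div, Real.norm_eq_abs, hs1,
        Real.norm_of_nonneg (norm_nonneg _), div_mul_cancel₀ _ hw']
    · simp only [real_inner_smul_right, real_inner_self_eq_norm_sq]
      rw [show s / ‖w‖ * ‖w‖ ^ 2 = s * ‖w‖ by field_simp]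
      rw [hs]; split_ifs with hc
      · rw [one_mul, abs_of_nonneg hc, abs_of_nonneg (by positivity)]
      · have hc' : c < 0 := not_le.mp hc
        have hn : 0 ≤ ‖w‖ := norm_nonneg w
        have hle : c + -1 * ‖w‖ ≤ 0 := by linarith
        rw [abs_of_neg hc', abs_of_nonpos hle]
        ring
  · rintro _ ⟨u, hu, rfl⟩
    rw [mem_closedBall_zero_iff] at hu
    calc |c + ⟪w, u⟫| ≤ |c| + |⟪w, u⟫| := abs_add_le _ _
      _ ≤ |c| + ‖w‖ * ‖u‖ := by gcongr; exact abs_real_inner_le_norm _ _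
      _ ≤ |c| + ‖w‖ := by nlinarith [norm_nonneg w]

variable [CompleteSpace V]

/-- **Row ellipsoid**: `sup_{a ∈ ℰ} |aᵀx − b| = |āᵀx − b| + ‖Pᵀx‖₂` for
`ℰ = {ā + Pu | ‖u‖₂ ≤ 1}` (the tree's `ellipsoid ā P`). [cite: BoydVandenberghe2004, §6.4.2] -/
theorem isGreatest_abs_residual_ellipsoid (abar : V) (P : V →L[ℝ] V) (x : V) (b : ℝ) :
    IsGreatest ((fun a : V => |⟪a, x⟫ - b|) '' ellipsoid abar P)
      (|⟪abar, x⟫ - b| + ‖adjoint P x‖) := by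
  have key : ∀ u : V, |⟪abar + P u, x⟫ - b| = |(⟪abar, x⟫ - b) + ⟪adjoint P x, u⟫| := fun u => by
    rw [inner_add_left, inner_apply_eq_inner_adjoint]; ring_nf
  have h := isGreatest_abs_add_inner_closedBall (⟪abar, x⟫ - b) (adjoint P x)
  constructor
  · obtain ⟨u, hu, hu'⟩ := h.1
    refine ⟨abar + P u, ⟨u, mem_closedBall_zero_iff.mp hu, rfl⟩, ?_⟩
    show |⟪abar + P u, x⟫ - b| = _
    rw [key]; exact hu'
  · rintro _ ⟨a, ⟨u, hu, rfl⟩, rfl⟩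
    show |⟪abar + P u, x⟫ - b| ≤ _
    rw [key]
    exact h.2 ⟨u, mem_closedBall_zero_iff.mpr hu, rfl⟩

omit [CompleteSpace V] in
/-- Monotonicity-and-attainment step for the robust `ℓ₂` problem: if each residual `|rᵢ(A)|`
has greatest value `Mᵢ` over the `i`th row's uncertainty set and the rows vary independently
(some `A` attains all the `Mᵢ` at once), then `sup ‖r(A)‖₂ = (∑ Mᵢ²)^{1/2}`.
[cite: BoydVandenberghe2004, §6.4.2] -/
theorem isGreatest_euclidean_norm_of_rows {ι : Type*} [Fintype ι] {𝒜 : Type*} (S : Set 𝒜)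
    (r : 𝒜 → EuclideanSpace ℝ ι) (M : ι → ℝ)
    (hle : ∀ A ∈ S, ∀ i, |r A i| ≤ M i) (hatt : ∃ A ∈ S, ∀ i, |r A i| = M i) :
    IsGreatest ((fun A => ‖r A‖) '' S) (Real.sqrt (∑ i, M i ^ 2)) := by
  have hnorm : ∀ A, ‖r A‖ = Real.sqrt (∑ i, |r A i| ^ 2) := fun A => by
    rw [EuclideanSpace.norm_eq]; simp [Real.norm_eq_abs]
  constructor
  · obtain ⟨A, hA, hAi⟩ := hatt
    refine ⟨A, hA, ?_⟩
    show ‖r A‖ = _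
    rw [hnorm]; simp [hAi]
  · rintro _ ⟨A, hA, rfl⟩
    show ‖r A‖ ≤ _
    rw [hnorm]
    exact Real.sqrt_le_sqrt (Finset.sum_le_sum fun i _ =>
      pow_le_pow_left₀ (abs_nonneg _) (hle A hA i) 2)

/-- **Robust `ℓ₂` approximation with row ellipsoids**:
`e_wc(x) = sup {‖Ax − b‖₂ | aᵢ ∈ ℰᵢ} = (∑ᵢ (|āᵢᵀx − bᵢ| + ‖Pᵢᵀx‖₂)²)^{1/2}`, the matrix `A`
being given by its rows `a : ι → V` and `Ax − b` by `i ↦ aᵢᵀx − bᵢ`.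
[cite: BoydVandenberghe2004, §6.4.2] -/
theorem isGreatest_robust_l2 {ι : Type*} [Fintype ι] (abar : ι → V) (P : ι → V →L[ℝ] V)
    (b : ι → ℝ) (x : V) :
    IsGreatest ((fun a : ι → V => ‖(WithLp.toLp 2 fun i => ⟪a i, x⟫ - b i : EuclideanSpace ℝ ι)‖) ''
        {a | ∀ i, a i ∈ ellipsoid (abar i) (P i)})
      (Real.sqrt (∑ i, (|⟪abar i, x⟫ - b i| + ‖adjoint (P i) x‖) ^ 2)) := by
  refine isGreatest_euclidean_norm_of_rows {a : ι → V | ∀ i, a i ∈ ellipsoid (abar i) (P i)}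
    (fun a => WithLp.toLp 2 fun i => ⟪a i, x⟫ - b i)
    (fun i => |⟪abar i, x⟫ - b i| + ‖adjoint (P i) x‖)
    (fun a ha i => ?_) ?_
  · exact (isGreatest_abs_residual_ellipsoid (abar i) (P i) x (b i)).2 ⟨a i, ha i, rfl⟩
  · choose a ha heq using fun i => (isGreatest_abs_residual_ellipsoid (abar i) (P i) x (b i)).1
    exact ⟨a, ha, fun i => by simpa using heq i⟩

end Ellipsoids

/-! ## Robust Chebyshev approximation: `sup_{‖u‖∞ ≤ 1} |pᵀu + q| = ‖p‖₁ + |q|` -/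

section Chebyshev

variable {κ : Type*} [Fintype κ]

/-- With the `ℓ∞` norm on `u` (Lean's sup norm on `κ → ℝ`),
`sup_{‖u‖∞ ≤ 1} |pᵀu + q| = ‖p‖₁ + |q|`, attained at `uⱼ = ± sign pⱼ`.
[cite: BoydVandenberghe2004, §6.4.2] -/
theorem isGreatest_abs_dotProduct_add (p : κ → ℝ) (q : ℝ) :
    IsGreatest ((fun u : κ → ℝ => |p ⬝ᵥ u + q|) '' closedBall 0 1) (∑ j, |p j| + |q|) := by
  constructor
  · set s : ℝ := if 0 ≤ q then 1 else -1 with hs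
    have hs1 : |s| = 1 := by rw [hs]; split_ifs <;> simp
    refine ⟨fun j => if 0 ≤ p j then s else -s, ?_, ?_⟩
    · rw [mem_closedBall_zero_iff, pi_norm_le_iff_of_nonneg zero_le_one]
      intro j; split_ifs <;> simp [hs1]
    · have hj : ∀ j, p j * (if 0 ≤ p j then s else -s) = s * |p j| := fun j => by
        split_ifs with h
        · rw [abs_of_nonneg h, mul_comm]
        · rw [abs_of_neg (not_le.mp h)]; ring
      simp only [dotProduct, hj, ← Finset.mul_sum]
      have hP : 0 ≤ ∑ j, |p j| := Finset.sum_nonneg fun j _ => abs_nonneg _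
      rw [hs]; split_ifs with hq
      · rw [one_mul, abs_of_nonneg (by positivity), abs_of_nonneg hq]
      · rw [neg_one_mul, abs_of_nonpos (by linarith [not_le.mp hq]), abs_of_neg (not_le.mp hq)]
        ring
  · rintro _ ⟨u, hu, rfl⟩
    rw [mem_closedBall_zero_iff] at hu
    have huj : ∀ j, |u j| ≤ 1 := fun j => (Real.norm_eq_abs _ ▸ norm_le_pi_norm u j).trans hu
    calc |p ⬝ᵥ u + q| ≤ |p ⬝ᵥ u| + |q| := abs_add_le _ _
      _ ≤ ∑ j, |p j * u j| + |q| := by gcongr; exact Finset.abs_sum_le_sum_abs _ _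
      _ ≤ ∑ j, |p j| + |q| := add_le_add (Finset.sum_le_sum fun j _ => by
          rw [abs_mul]; exact mul_le_of_le_one_right (abs_nonneg _) (huj j)) le_rfl

/-- Hence, for the structured uncertainty `Ā + u₁A₁ + ⋯ + u_pA_p`, `‖u‖∞ ≤ 1`, the worst case of
the `i`th residual `|pᵢ(x)ᵀu + qᵢ(x)|` is `‖pᵢ(x)‖₁ + |qᵢ(x)|` and
`e_wc(x) = maxᵢ (‖pᵢ(x)‖₁ + |qᵢ(x)|)`: the `ℓ∞` norm of the residual vector over the ball is
greatest at this value. [cite: BoydVandenberghe2004, §6.4.2] -/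
theorem isGreatest_robust_chebyshev {ι : Type*} [Fintype ι] [Nonempty ι] (p : ι → κ → ℝ)
    (q : ι → ℝ) :
    IsGreatest ((fun u : κ → ℝ => ‖fun i => p i ⬝ᵥ u + q i‖) '' closedBall 0 1)
      (Finset.univ.sup' Finset.univ_nonempty fun i => ∑ j, |p i j| + |q i|) := by
  constructor
  · obtain ⟨i, -, hi⟩ :=
      Finset.exists_mem_eq_sup' Finset.univ_nonempty fun i => ∑ j, |p i j| + |q i|
    obtain ⟨u, hu, hu'⟩ := (isGreatest_abs_dotProduct_add (p i) (q i)).1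
    have hu'' : |p i ⬝ᵥ u + q i| = ∑ j, |p i j| + |q i| := hu'
    refine ⟨u, hu, le_antisymm ?_ ?_⟩
    · show ‖fun k => p k ⬝ᵥ u + q k‖ ≤ _
      rw [pi_norm_le_iff_of_nonneg (by rw [hi]; positivity)]
      intro k
      rw [Real.norm_eq_abs]
      exact ((isGreatest_abs_dotProduct_add (p k) (q k)).2 ⟨u, hu, rfl⟩).trans
        (Finset.le_sup' (fun i => ∑ j, |p i j| + |q i|) (Finset.mem_univ k))
    · show _ ≤ ‖fun k => p k ⬝ᵥ u + q k‖
      rw [hi, ← hu'', ← Real.norm_eq_abs]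
      exact norm_le_pi_norm (fun k => p k ⬝ᵥ u + q k) i
  · rintro _ ⟨u, hu, rfl⟩
    show ‖fun k => p k ⬝ᵥ u + q k‖ ≤ _
    rw [pi_norm_le_iff_of_nonneg (by
      obtain ⟨i⟩ := ‹Nonempty ι›
      exact le_trans (by positivity) (Finset.le_sup' (fun i => ∑ j, |p i j| + |q i|)
        (Finset.mem_univ i)))]
    intro i
    rw [Real.norm_eq_abs]
    exact ((isGreatest_abs_dotProduct_add (p i) (q i)).2 ⟨u, hu, rfl⟩).trans
      (Finset.le_sup' (fun i => ∑ j, |p i j| + |q i|) (Finset.mem_univ i))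

end Chebyshev

end

end Literature.Analysis.Convex.WorstCaseRobustApproximation
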